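import Mathlib
import Literature.NumberTheory.Sieve.IntervalResidueClassSieve
import Summits.Parity.GeneralizedHardyLittlewood.Theorems.ParityLeakOneFifthPlainSplitRoughMass
import Summits.Parity.GeneralizedHardyLittlewood.Theorems.ParityLeakOneFifthParityLeakSieveTwistedCellP
import Summits.Parity.GeneralizedHardyLittlewood.Theorems.ParityLeakOneFifthParityLeakSieveCornerSum
import Summits.Parity.GeneralizedHardyLittlewood.Theorems.ParityLeakOneFifthParityLeakSieveCornerCount
import HarnessLib

/-!
# Route ParityLeakOneFifth, crux `ParityLeakSieve` (stmt-Parity-18381), skeleton `birth`: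
# the corner count of stub S2 is `≤ δ V x/log x`

With `z = exp((log log x)²)`, `V = ∏_{p<z}(1 − 1/p)`, `y = x^{1/5}`, `D = x^{1/2−2ε}`: for every
`δ > 0` there is `ε₀ > 0` such that for `0 < ε ≤ ε₀` and `x ≥ x₀(ε)`,
`Σ_{n ∈ (x,2x], n z-rough, y ≤ P⁻(n+2), Ω(n+2)=4} #{d ∣ n+2 : Ω d = 2, D < d, d² < n+2} ≤ δ V x/log x`
(`corner_le`).  Proof: exchange of summation (`corner_exchange_le`), the `P`-twisted cell sieve at
level `z` (`twistedCellP_sieve_le`), the cell bound `#Φ₂ ≤ C X/log y` (`exists_card_cellTwo_le`),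
`Σ 1/d ≤ C(ε + 1/log x)` over the corner divisors (`exists_sum_inv_cornerDivisors_le`),
`V_sh ≤ 2V`, `V ≥ c/(log z)²`.
-/

namespace Summit.Parity.GeneralizedHardyLittlewood.Theorems.ParityLeakOneFifth

open Finset Real
open scoped ArithmeticFunction.Omega
open Literature.NumberTheory.Sieve

/-- `V(z) ≥ c/(log z)²` for `z ≥ 2`, absolute `c > 0` (the tree's `le_prod_one_sub_card_div`). -/
theorem exists_V_lower : ∃ c : ℝ, 0 < c ∧ ∀ z : ℝ, 2 ≤ z →
    c / Real.log z ^ 2 ≤ ∏ p ∈ (Finset.range ⌈z⌉₊).filter Nat.Prime, (1 - 1 / (p : ℝ)) := by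
  obtain ⟨c, hc, hV⟩ := IntervalClassSieve.le_prod_one_sub_card_div 1
  refine ⟨c, hc, fun z hz => ?_⟩
  have hPB : Nat.primesBelow ⌈z⌉₊ = (Finset.range ⌈z⌉₊).filter Nat.Prime := rfl
  have h := hV (fun _ => ({0} : Finset ℕ)) (fun p _ => by rw [Finset.card_singleton])
    (fun p hp => by rw [Finset.card_singleton]; exact hp.one_lt) z hz
  rw [hPB, show (2 * 1 : ℕ) = 2 by norm_num] at h
  refine h.trans (le_of_eq (Finset.prod_congr rfl fun p _ => ?_))
  rw [Finset.card_singleton, Nat.cast_one]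

/-- The arithmetic of `corner_le` over real variables. -/
theorem corner_arith {S W CD Cc C₁ C₂ V Vsh x il ε δ K₁ : ℝ} (hCD : 0 ≤ CD) (hCc : 0 ≤ Cc)
    (hC₁ : 0 < C₁) (hC₂ : 0 ≤ C₂) (hV : 0 ≤ V) (hx : 0 < x) (hil : 0 < il) (hil1 : il ≤ 1)
    (hε : 0 < ε) (hε1 : ε ≤ 1) (hδ : 0 < δ)
    (hS : S ≤ W * (CD * (ε + il)))
    (hW : W = 4 * x * (5 * Cc * Vsh * (1 + C₁) * il + 32 * C₂ * il ^ 2)) (hVsh : Vsh ≤ 2 * V)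
    (hK₁ : K₁ = 160 * CD * (Cc + 1) * (1 + C₁) + 1) (hεK : ε ≤ δ / K₁)
    (hilK : il ≤ δ / K₁) (hBV : 512 * CD * C₂ * il ≤ δ * V) : S ≤ δ * V * x * il := by
  have hK₁0 : 0 < K₁ := by rw [hK₁]; positivity
  have hsum : ε + il ≤ 2 * δ / K₁ := by
    have e : 2 * δ / K₁ = δ / K₁ + δ / K₁ := by ring
    rw [e]; exact add_le_add hεK hilK
  have hT1 : 40 * CD * Cc * (1 + C₁) * (ε + il) ≤ δ / 2 := by
    have h1 : 40 * CD * Cc * (1 + C₁) * (ε + il) ≤ 40 * CD * Cc * (1 + C₁) * (2 * δ / K₁) :=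
      mul_le_mul_of_nonneg_left hsum (by positivity)
    have h2 : 40 * CD * Cc * (1 + C₁) * (2 * δ / K₁) ≤ δ / 2 := by
      rw [show 40 * CD * Cc * (1 + C₁) * (2 * δ / K₁) = (80 * CD * Cc * (1 + C₁)) * δ / K₁ by ring,
        div_le_iff₀ hK₁0, hK₁]
      have : 80 * CD * Cc * (1 + C₁) * δ ≤ δ / 2 * (160 * CD * (Cc + 1) * (1 + C₁)) := by
        have : CD * Cc * (1 + C₁) ≤ CD * (Cc + 1) * (1 + C₁) := by
          apply mul_le_mul_of_nonneg_right _ (by linarith)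
          exact mul_le_mul_of_nonneg_left (by linarith) hCD
        nlinarith
      nlinarith
    linarith
  have hT2 : 128 * CD * C₂ * (ε + il) * il ≤ δ * V / 2 := by
    have h1 : ε + il ≤ 2 := by linarith
    have h2 : 128 * CD * C₂ * (ε + il) * il ≤ 128 * CD * C₂ * 2 * il := by
      have : 0 ≤ 128 * CD * C₂ * il := by positivity
      nlinarith
    linarith
  have hmain : W * (CD * (ε + il)) ≤ x * il * (40 * CD * Cc * (1 + C₁) * (ε + il) * V +
      128 * CD * C₂ * (ε + il) * il) := by
    rw [hW]
    have h1 : 5 * Cc * Vsh * (1 + C₁) * il ≤ 10 * Cc * V * (1 + C₁) * il := by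
      have : 0 ≤ 5 * Cc * (1 + C₁) * il := by positivity
      nlinarith
    have h2 : 0 ≤ 4 * x * (CD * (ε + il)) := by positivity
    calc 4 * x * (5 * Cc * Vsh * (1 + C₁) * il + 32 * C₂ * il ^ 2) * (CD * (ε + il))
        = (4 * x * (CD * (ε + il))) * (5 * Cc * Vsh * (1 + C₁) * il + 32 * C₂ * il ^ 2) := by ring
      _ ≤ (4 * x * (CD * (ε + il))) * (10 * Cc * V * (1 + C₁) * il + 32 * C₂ * il ^ 2) :=
          mul_le_mul_of_nonneg_left (by linarith) h2
      _ = x * il * (40 * CD * Cc * (1 + C₁) * (ε + il) * V + 128 * CD * C₂ * (ε + il) * il) := by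
          ring
  have hfin : 40 * CD * Cc * (1 + C₁) * (ε + il) * V + 128 * CD * C₂ * (ε + il) * il ≤ δ * V := by
    have := mul_le_mul_of_nonneg_right hT1 hV
    linarith
  calc S ≤ W * (CD * (ε + il)) := hS
    _ ≤ x * il * (40 * CD * Cc * (1 + C₁) * (ε + il) * V + 128 * CD * C₂ * (ε + il) * il) := hmain
    _ ≤ x * il * (δ * V) := mul_le_mul_of_nonneg_left hfin (by positivity)
    _ = δ * V * x * il := by ring

/-- The Bombieri–Vinogradov error term at one height: `C₂ X/log²X ≤ 16 C₂ X₂/ℓ²` when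
`log X ≥ ℓ/4`, `X ≤ X₂`. -/
theorem bv_term_le {C₂ X X₂ ℓ il : ℝ} (hC₂ : 0 ≤ C₂) (hX : 0 < X) (hlX : ℓ / 4 ≤ Real.log X)
    (hXle : X ≤ X₂) (hil : il = 1 / ℓ) (hℓ : 0 < ℓ) :
    C₂ * X / Real.log X ^ (2 : ℝ) ≤ 16 * C₂ * X₂ * il ^ 2 := by
  rw [Real.rpow_two]
  have hl0 : 0 < Real.log X := by linarith
  calc C₂ * X / Real.log X ^ 2 ≤ C₂ * X / (ℓ / 4) ^ 2 := by
        exact div_le_div_of_nonneg_left (by positivity) (by positivity)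
          (pow_le_pow_left₀ (by positivity) hlX 2)
    _ ≤ C₂ * X₂ / (ℓ / 4) ^ 2 :=
        div_le_div_of_nonneg_right (mul_le_mul_of_nonneg_left hXle hC₂) (by positivity)
    _ = 16 * C₂ * X₂ * il ^ 2 := by rw [hil]; field_simp; ring

/-- The arithmetic of the bound for one corner divisor `d`, over real variables. -/
theorem corner_d_arith {B c2 c1 Vsh C₁ E Cc C₂ X₂ ℓ il x d : ℝ}
    (hB : B ≤ (c2 - c1) * Vsh * (1 + C₁ * Real.exp (-1)) + E) (hc2 : c2 ≤ Cc * X₂ / (ℓ / 5))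
    (hc1 : 0 ≤ c1) (hVsh0 : 0 ≤ Vsh) (hE : E ≤ 16 * C₂ * X₂ * il ^ 2 + 16 * C₂ * X₂ * il ^ 2)
    (hil : il = 1 / ℓ) (hℓ : 0 < ℓ) (hX₂ : X₂ ≤ 4 * x / d) (hX₂0 : 0 ≤ X₂) (hC₁ : 0 < C₁)
    (hCc : 0 ≤ Cc) (hC₂ : 0 ≤ C₂) :
    B ≤ (1 / d) * (4 * x * (5 * Cc * Vsh * (1 + C₁) * il + 32 * C₂ * il ^ 2)) := by
  have hexp : 1 + C₁ * Real.exp (-1) ≤ 1 + C₁ := by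
    have h1 : Real.exp (-1) ≤ 1 := Real.exp_le_one_iff.2 (by norm_num)
    have h2 := mul_le_mul_of_nonneg_left h1 hC₁.le
    linarith
  have hexp0 : 0 ≤ 1 + C₁ * Real.exp (-1) := by positivity
  have hU0 : 0 ≤ Cc * X₂ / (ℓ / 5) := by positivity
  have hdiff : c2 - c1 ≤ Cc * X₂ / (ℓ / 5) := by linarith
  have hm : (c2 - c1) * Vsh * (1 + C₁ * Real.exp (-1)) ≤ (Cc * X₂ / (ℓ / 5)) * Vsh * (1 + C₁) := by
    by_cases h0 : 0 ≤ c2 - c1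
    · exact mul_le_mul (mul_le_mul_of_nonneg_right hdiff hVsh0) hexp hexp0 (by positivity)
    · rw [not_le] at h0
      have : (c2 - c1) * Vsh * (1 + C₁ * Real.exp (-1)) ≤ 0 := by
        have := mul_nonpos_iff.2 (Or.inr ⟨h0.le, hVsh0⟩)
        exact mul_nonpos_iff.2 (Or.inr ⟨this, hexp0⟩)
      have : 0 ≤ (Cc * X₂ / (ℓ / 5)) * Vsh * (1 + C₁) := by positivity
      linarith
  have e : (Cc * X₂ / (ℓ / 5)) * Vsh * (1 + C₁) + (16 * C₂ * X₂ * il ^ 2 + 16 * C₂ * X₂ * il ^ 2) =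
      X₂ * (5 * Cc * Vsh * (1 + C₁) * il + 32 * C₂ * il ^ 2) := by
    rw [hil]; field_simp; ring
  have hfin : X₂ * (5 * Cc * Vsh * (1 + C₁) * il + 32 * C₂ * il ^ 2) ≤
      (1 / d) * (4 * x * (5 * Cc * Vsh * (1 + C₁) * il + 32 * C₂ * il ^ 2)) := by
    rw [show (1 / d) * (4 * x * (5 * Cc * Vsh * (1 + C₁) * il + 32 * C₂ * il ^ 2)) =
      (4 * x / d) * (5 * Cc * Vsh * (1 + C₁) * il + 32 * C₂ * il ^ 2) by ring]
    exact mul_le_mul_of_nonneg_right hX₂ (by rw [hil]; positivity)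
  linarith

set_option maxHeartbeats 1600000 in
/-- **The corner count is `≤ δ V x/log x`.** For every `δ > 0` there is `ε₀ > 0` such that for
`0 < ε ≤ ε₀` and `x ≥ x₀(ε)`, with `z = exp((log log x)²)`, `V = ∏_{p<z}(1 − 1/p)`:
`Σ_{n ∈ (x,2x], n z-rough, x^{1/5} ≤ P⁻(n+2), Ω(n+2) = 4} #{d ∣ n+2 : Ω d = 2, x^{1/2−2ε} < d, d² < n+2}
 ≤ δ V x/log x`. -/
theorem corner_le : ∀ δ : ℝ, 0 < δ → ∃ ε₀ : ℝ, 0 < ε₀ ∧ ∀ ε : ℝ, 0 < ε → ε ≤ ε₀ →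
    ∃ x₀ : ℕ, ∀ x : ℕ, x₀ ≤ x → ∀ (z V : ℝ), z = Real.exp (Real.log (Real.log (x : ℝ)) ^ 2) →
      V = ∏ p ∈ (Finset.range ⌈z⌉₊).filter Nat.Prime, (1 - 1 / (p : ℝ)) →
      ∑ n ∈ (Finset.Ioc x (2 * x)).filter (fun n : ℕ => (∀ p ∈ n.primeFactors, z ≤ (p : ℝ)) ∧
          (x : ℝ) ^ ((1 : ℝ) / 5) ≤ ((n + 2).minFac : ℝ) ∧ ArithmeticFunction.cardFactors (n + 2) = 4),
        (#((Nat.divisors (n + 2)).filter (fun d : ℕ => ArithmeticFunction.cardFactors d = 2 ∧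
            (x : ℝ) ^ ((1 : ℝ) / 2 - 2 * ε) < (d : ℝ) ∧ d * d < n + 2)) : ℝ) ≤
        δ * V * (x : ℝ) / Real.log (x : ℝ) := by
  intro δ hδ
  obtain ⟨C₁, C₂, hC₁, hC₂, hTC⟩ := twistedCellP_sieve_le 1 3 2
  obtain ⟨Cc, hCc, hcell⟩ := exists_card_cellTwo_le
  obtain ⟨CD, hCD, hDsum⟩ := exists_sum_inv_cornerDivisors_le
  obtain ⟨c, hc, hVlow⟩ := exists_V_lower
  set K₁ : ℝ := 160 * CD * (Cc + 1) * (1 + C₁) + 1 with hK₁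
  have hK₁0 : 0 < K₁ := by positivity
  refine ⟨min (1 / 50) (δ / K₁), by positivity, fun ε hε hεle => ?_⟩
  have hε50 : ε ≤ 1 / 50 := hεle.trans (min_le_left _ _)
  have hεK : ε ≤ δ / K₁ := hεle.trans (min_le_right _ _)
  obtain ⟨x₁, hx₁⟩ := hDsum ε hε hε50
  -- growth in `t = log log x`
  set M : ℝ := max 100 (K₁ / δ) with hM
  obtain ⟨T₁, hT₁1, hT₁⟩ := exists_quadratic_le_exp 16 0 M
  obtain ⟨T₂, -, hT₂⟩ := exists_pow_four_le_mul_exp (κ := δ * c / (512 * CD * C₂ + 1)) (by positivity)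
  obtain ⟨x₂, hx₂⟩ := exists_nat_loglog_ge (max T₁ T₂)
  refine ⟨max x₁ x₂, fun x hx => ?_⟩
  rintro z V rfl rfl
  have hxx₁ : x₁ ≤ x := (le_max_left _ _).trans hx
  have hxx₂ : x₂ ≤ x := (le_max_right _ _).trans hx
  obtain ⟨hxE, hlogx, hTt⟩ := hx₂ x hxx₂
  set t : ℝ := Real.log (Real.log (x : ℝ)) with ht
  have hT₁t : T₁ ≤ t := (le_max_left _ _).trans hTt
  have hT₂t : T₂ ≤ t := (le_max_right _ _).trans hTt
  have ht1 : 1 ≤ t := hT₁1.trans hT₁t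
  have ht0 : 0 < t := by linarith
  have hx0 : (0 : ℝ) < x := (Real.exp_pos _).trans_le hxE
  have hlogpos : 0 < Real.log (x : ℝ) := (Real.exp_pos _).trans_le hlogx
  set ℓ : ℝ := Real.log (x : ℝ) with hℓ
  have hexpt : Real.exp t = ℓ := by rw [ht, Real.exp_log hlogpos]
  have hgrow := hT₁ t hT₁t
  rw [hexpt] at hgrow
  have hM100 : (100 : ℝ) ≤ M := le_max_left _ _
  have hMK : K₁ / δ ≤ M := le_max_right _ _
  have hℓ100 : 100 ≤ ℓ := by nlinarith [sq_nonneg t]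
  have hℓK : K₁ / δ ≤ ℓ := by nlinarith [sq_nonneg t]
  have ht2ℓ : 16 * t ^ 2 ≤ ℓ := by linarith [le_max_left (100 : ℝ) (K₁ / δ)]
  have hx1 : (1 : ℝ) < x := by
    have : Real.exp 0 < Real.exp (Real.exp (max T₁ T₂)) := Real.exp_lt_exp.2 (Real.exp_pos _)
    rw [Real.exp_zero] at this; linarith
  have hxℓ : (x : ℝ) = Real.exp ℓ := by rw [hℓ, Real.exp_log hx0]
  -- `z`, `V`, `V_sh`
  set z : ℝ := Real.exp (t ^ 2) with hz
  have hz2 : 2 < z := by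
    have h1 : Real.exp 1 ≤ z := Real.exp_le_exp.2 (by nlinarith)
    have h2 : (2 : ℝ) < Real.exp 1 := by have := Real.exp_one_gt_d9; linarith
    linarith
  have hlogz : Real.log z = t ^ 2 := by rw [hz, Real.log_exp]
  set V : ℝ := ∏ p ∈ (Finset.range ⌈z⌉₊).filter Nat.Prime, (1 - 1 / (p : ℝ)) with hV
  set Vsh : ℝ := ∏ p ∈ (Finset.range ⌈z⌉₊).filter (fun p : ℕ => p.Prime ∧ p ≠ 2),
    (1 - 1 / ((p : ℝ) - 1)) with hVsh
  have hVc : c / t ^ 4 ≤ V := by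
    have h := hVlow z hz2.le; rw [hlogz, show (t ^ 2) ^ 2 = t ^ 4 by ring] at h; exact h
  have hV0 : 0 < V := lt_of_lt_of_le (by positivity) hVc
  have hVshV : Vsh ≤ 2 * V := Vsh_le_two_mul_V hz2
  have hVsh0 : 0 ≤ Vsh := le_trans (V_le_Vsh hz2 |> le_trans hV0.le) le_rfl
  -- `y`, `D`
  set y : ℝ := (x : ℝ) ^ ((1 : ℝ) / 5) with hy
  set D : ℝ := (x : ℝ) ^ ((1 : ℝ) / 2 - 2 * ε) with hD
  have hy0 : 0 < y := Real.rpow_pos_of_pos hx0 _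
  have hD0 : 0 < D := Real.rpow_pos_of_pos hx0 _
  have hlogy : Real.log y = ℓ / 5 := by rw [hy, Real.log_rpow hx0]; ring
  have hyexp : y = Real.exp (ℓ / 5) := by rw [← hlogy, Real.exp_log hy0]
  have hlogD : Real.log D = (1 / 2 - 2 * ε) * ℓ := by rw [hD, Real.log_rpow hx0]
  have hDexp : D = Real.exp ((1 / 2 - 2 * ε) * ℓ) := by rw [← hlogD, Real.exp_log hD0]
  have hzy : z ≤ y := by rw [hyexp, hz]; exact Real.exp_le_exp.2 (by linarith)
  have hey : Real.exp 1 ≤ y := by rw [hyexp]; exact Real.exp_le_exp.2 (by linarith)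
  have hlog4 : Real.log 4 ≤ 2 := by
    have := Real.log_two_lt_d9
    rw [show (4 : ℝ) = 2 ^ 2 by norm_num, Real.log_pow]; push_cast; linarith
  -- `√x`
  set s : ℝ := Real.exp (ℓ / 2) with hs
  have hs0 : 0 < s := Real.exp_pos _
  have hsx : s ^ 2 = x := by rw [hs, ← Real.exp_nat_mul, hxℓ]; ring_nf
  have hs4 : 4 ≤ s := by
    have h1 : Real.log 4 ≤ ℓ / 2 := by linarith
    have := Real.exp_le_exp.2 h1
    rwa [Real.exp_log (by norm_num : (0 : ℝ) < 4)] at this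
  -- the exchange of summation
  refine (corner_exchange_le x z y D).trans ?_
  set 𝒟 := (Finset.range (2 * x + 3)).filter (fun d : ℕ => ArithmeticFunction.cardFactors d = 2 ∧
      (∀ p ∈ d.primeFactors, y ≤ (p : ℝ)) ∧ D < (d : ℝ) ∧ d * d ≤ 2 * x + 2) with h𝒟
  set il : ℝ := 1 / ℓ with hil
  have hil0 : 0 < il := by positivity
  have hil1 : il ≤ 1 := by rw [hil, div_le_one hlogpos]; linarith
  set W : ℝ := 4 * x * (5 * Cc * Vsh * (1 + C₁) * il + 32 * C₂ * il ^ 2) with hW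
  have hW0 : 0 ≤ W := by positivity
  -- the bound for one `d`
  have hper : ∀ d ∈ 𝒟, (#((Finset.Ioc x (2 * x)).filter (fun m : ℕ => (∀ p ∈ m.primeFactors, z ≤ (p : ℝ)) ∧
      d ∣ m + 2 ∧ ⌈y⌉₊ ≤ ((m + 2) / d).minFac ∧ ArithmeticFunction.cardFactors ((m + 2) / d) = 2)) : ℝ) ≤
      (1 / (d : ℝ)) * W := by
    intro d hd
    rw [h𝒟, Finset.mem_filter] at hd
    obtain ⟨-, hΩd, hdr, hDd, hdd⟩ := hd
    have hd0 : d ≠ 0 := by rintro rfl; simp at hΩd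
    have hdpos : 0 < d := Nat.pos_of_ne_zero hd0
    have hdR : (0 : ℝ) < d := by exact_mod_cast hdpos
    have hdP : ∀ p : ℕ, p.Prime → p ∣ d → y ≤ (p : ℝ) := fun p hp hpd =>
      hdr p (Nat.mem_primeFactors.2 ⟨hp, hpd, hd0⟩)
    -- the two heights
    set X₂ : ℕ := (2 * x + 2) / d with hX₂
    set X₁ : ℕ := (x + 2) / d with hX₁
    have hX₁X₂ : X₁ ≤ X₂ := Nat.div_le_div_right (by omega)
    have hd2s : (d : ℝ) ≤ 2 * s := by
      have h1 : ((d : ℝ)) ^ 2 ≤ 2 * x + 2 := by exact_mod_cast (by nlinarith [hdd] : d ^ 2 ≤ 2 * x + 2)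
      have h2 : (2 * (x : ℝ) + 2) ≤ (2 * s) ^ 2 := by rw [mul_pow, hsx]; nlinarith
      nlinarith [sq_nonneg ((d : ℝ) - 2 * s), hs0]
    have hX₁low : s / 4 ≤ (X₁ : ℝ) := by
      have h1 : ((x : ℝ) + 2) < (X₁ : ℝ) * d + d := by
        have := Nat.lt_div_mul_add (a := x + 2) hdpos
        rw [← hX₁] at this; exact_mod_cast this
      have h2 : (x : ℝ) + 2 ≥ s * s / 1 := by rw [div_one, ← pow_two, hsx]; linarith
      -- `X₁ ≥ (x+2)/d − 1 ≥ s²/(2s) − 1 = s/2 − 1 ≥ s/4`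
      have h3 : s * s ≤ ((X₁ : ℝ) + 1) * (2 * s) := by
        calc s * s ≤ (x : ℝ) + 2 := by linarith
          _ ≤ ((X₁ : ℝ) + 1) * d := by linarith
          _ ≤ ((X₁ : ℝ) + 1) * (2 * s) := mul_le_mul_of_nonneg_left hd2s (by positivity)
      have h4 : s ≤ ((X₁ : ℝ) + 1) * 2 := le_of_mul_le_mul_right (by linarith) hs0
      linarith
    have hX₁pos : (0 : ℝ) < (X₁ : ℝ) := by linarith
    have hX₂pos : (0 : ℝ) < (X₂ : ℝ) := lt_of_lt_of_le hX₁pos (by exact_mod_cast hX₁X₂)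
    have hX₂le : (X₂ : ℝ) ≤ 4 * x / d := by
      calc (X₂ : ℝ) ≤ (2 * (x : ℝ) + 2) / d := by
            have := Nat.cast_div_le (m := 2 * x + 2) (n := d) (α := ℝ)
            rw [← hX₂] at this; push_cast at this; exact this
        _ ≤ 4 * x / d := div_le_div_of_nonneg_right (by linarith) hdR.le
    have hyX₁ : y ≤ (X₁ : ℝ) := by
      refine le_trans ?_ hX₁low
      rw [hyexp, le_div_iff₀ (by norm_num : (0 : ℝ) < 4), hs]
      have h1 : Real.exp (ℓ / 5) * 4 = Real.exp (ℓ / 5 + Real.log 4) := by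
        rw [Real.exp_add, Real.exp_log (by norm_num)]
      rw [h1]; exact Real.exp_le_exp.2 (by linarith)
    have hlogX₁ : ℓ / 4 ≤ Real.log (X₁ : ℝ) := by
      have h1 : Real.log (s / 4) ≤ Real.log (X₁ : ℝ) := Real.log_le_log (by positivity) hX₁low
      rw [Real.log_div hs0.ne' (by norm_num), hs, Real.log_exp] at h1
      linarith
    have hlogX₂ : ℓ / 4 ≤ Real.log (X₂ : ℝ) :=
      hlogX₁.trans (Real.log_le_log hX₁pos (by exact_mod_cast hX₁X₂))
    have hlogX₂up : Real.log (X₂ : ℝ) ≤ (3 : ℕ) * Real.log y := by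
      rw [hlogy]
      have h1 : Real.log (X₂ : ℝ) ≤ Real.log (4 * x / D) := by
        refine Real.log_le_log hX₂pos (hX₂le.trans ?_)
        exact div_le_div_of_nonneg_left (by positivity) hD0 hDd.le
      have h2 : Real.log (4 * x / D) = Real.log 4 + ℓ - (1 / 2 - 2 * ε) * ℓ := by
        rw [Real.log_div (by positivity) hD0.ne', Real.log_mul (by norm_num) hx0.ne', hlogD]
      rw [h2] at h1
      push_cast
      nlinarith
    have hzX₁ : z ≤ ((X₁ : ℕ) : ℝ) ^ ((1 : ℝ) / 4) := by
      have h1 : Real.exp (ℓ / 4) ≤ (X₁ : ℝ) := by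
        rw [← Real.exp_log hX₁pos]; exact Real.exp_le_exp.2 hlogX₁
      have h2 : Real.exp (ℓ / 16) ≤ ((X₁ : ℕ) : ℝ) ^ ((1 : ℝ) / 4) := by
        have := Real.rpow_le_rpow (Real.exp_pos _).le h1 (by norm_num : (0 : ℝ) ≤ 1 / 4)
        rw [← Real.exp_mul] at this
        convert this using 2; ring
      refine le_trans ?_ h2
      rw [hz]; exact Real.exp_le_exp.2 (by linarith)
    -- the sieve step
    have hS := hTC x d z z y hdpos hz2 le_rfl hzy hdP hyX₁ hlogX₂up hzX₁
    rw [show Real.log z / Real.log z = 1 from div_self (by rw [hlogz]; positivity)] at hS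
    -- the cell bound at height `X₂`
    have hyX₂ : y ≤ (X₂ : ℝ) := hyX₁.trans (by exact_mod_cast hX₁X₂)
    have hC2 := hcell (X₂ : ℝ) y hey hyX₂ (by have := hlogX₂up; push_cast at this; linarith)
    rw [Nat.floor_natCast, hlogy] at hC2
    -- the Bombieri–Vinogradov error terms
    have hB2 := bv_term_le hC₂ hX₂pos hlogX₂ le_rfl hil hlogpos
    have hB1 := bv_term_le hC₂ hX₁pos hlogX₁ (by exact_mod_cast hX₁X₂ : (X₁ : ℝ) ≤ (X₂ : ℝ)) hil hlogpos
    exact corner_d_arith hS hC2 (Nat.cast_nonneg _) hVsh0 (add_le_add hB2 hB1) hil hlogpos hX₂le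
      hX₂pos.le hC₁ hCc hC₂
  -- sum over `d`
  have hsum := Finset.sum_le_sum hper
  refine hsum.trans ?_
  rw [← Finset.sum_mul]
  have hDs := hx₁ x hxx₁
  have hS' : (∑ d ∈ 𝒟, 1 / (d : ℝ)) * W ≤ W * (CD * (ε + il)) := by
    rw [mul_comm]; exact mul_le_mul_of_nonneg_left hDs hW0
  -- growth for the BV term: `512 CD C₂ il ≤ δ V`
  have hBV : 512 * CD * C₂ * il ≤ δ * V := by
    have h4 := hT₂ t hT₂t
    rw [hexpt] at h4
    have ht4 : 0 < t ^ 4 := by positivity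
    -- `(512 CD C₂ + 1) t⁴ ≤ δ c ℓ`, `V ≥ c/t⁴`
    have h5 : (512 * CD * C₂ + 1) * t ^ 4 ≤ δ * c * ℓ := by
      have := mul_le_mul_of_nonneg_left h4 (by positivity : (0 : ℝ) ≤ 512 * CD * C₂ + 1)
      rw [show (512 * CD * C₂ + 1) * (δ * c / (512 * CD * C₂ + 1) * ℓ) = δ * c * ℓ by
        field_simp] at this
      exact this
    have h6 : 512 * CD * C₂ * il ≤ δ * (c / t ^ 4) := by
      rw [hil, show δ * (c / t ^ 4) = δ * c / t ^ 4 by ring, le_div_iff₀ ht4,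
        show 512 * CD * C₂ * (1 / ℓ) * t ^ 4 = (512 * CD * C₂ * t ^ 4) / ℓ by ring,
        div_le_iff₀ hlogpos]
      nlinarith
    exact h6.trans (mul_le_mul_of_nonneg_left hVc hδ.le)
  have hilK : il ≤ δ / K₁ := by
    rw [hil, div_le_div_iff₀ hlogpos hK₁0, one_mul]
    have := (div_le_iff₀ hδ).1 hℓK
    linarith
  have key := corner_arith (S := (∑ d ∈ 𝒟, 1 / (d : ℝ)) * W) hCD.le hCc hC₁ hC₂ hV0.le hx0 hil0 hil1 hε
    (by linarith) hδ hS' hW hVshV hK₁ hεK hilK hBV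
  rw [hil] at key
  calc (∑ d ∈ 𝒟, 1 / (d : ℝ)) * W ≤ δ * V * x * (1 / ℓ) := key
    _ = δ * V * x / ℓ := by ring

end Summit.Parity.GeneralizedHardyLittlewood.Theorems.ParityLeakOneFifth
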